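import Mathlib.MeasureTheory.Measure.Hausdorff
import Mathlib.Analysis.InnerProductSpace.PiL2
import Summits.QuantumFields.YangMills.Theorems.LangevinControlUVFemtoCurvatureTwoPointCCoreBridge
import Summits.QuantumFields.YangMills.Theorems.LangevinControlUVFemtoCurvatureTwoPointCStubExpCommutatorBracket
import Summits.QuantumFields.YangMills.Theorems.LangevinControlUVFemtoCurvatureTwoPointCStubKoszulH1
import Summits.QuantumFields.YangMills.Theorems.LangevinControlUVFemtoCurvatureTwoPointCStubHaarCoLipschitz
import Summits.QuantumFields.YangMills.Theorems.LangevinControlUVFemtoCurvatureTwoPointCStubSecondMomentOfDoubling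
import Summits.QuantumFields.YangMills.Theorems.LangevinControlUVFemtoCurvatureTwoPointCStubSmallTorusOfSecondMoment
import Summits.QuantumFields.YangMills.Theorems.LangevinControlUVFemtoCurvatureTwoPointCDoublingSublevel

/-!
# Skeleton v7 — line `Sketch`, crux `FemtoCurvatureTwoPointC` (stmt-QuantumFields-16204), route `LangevinControlUV`

Continuation lead `prover-line-stmt-QuantumFields-16204-c5-0`, cycle 7. Everything below the open statements of v6 is LANDED
(vocabulary `…CDefs`/`…CDefsProfiles`/`…CDefsSplit`/`…CDefsCore`; E-a/E-b p123207/p123033; reductions p123348/p125592/p128493/p130359;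
RP pairs bridge p127516/p127848; femto-box / small-torus split p127987; longitudinal RP p130109/p130056/p129867/p130007; bridges
p130194). v6 had 2 sorries: `stub_afProfilesCore` (THE PHYSICS, crux-sized) and `stub_wilsonPartitionRV` (= the Literature NAMED
FACT `WilsonPartitionRegularVariation`, Hironaka-class).

WHAT v7 CHANGES (and why). The small-torus half of the v5 split (`SmallTorusVarianceLaw`: `Var_{L,β}(P) ≤ K/β²` on `2 ≤ L ≤ 7`)
is taken OFF the named fact. It needs only DOUBLING of the sublevel volumes `V(t) = Haar^E{S ≤ t}` of Wilson's action near
`t = 0`, and doubling does not need resolution of singularities for this phase: the flat set `{S = 0}` is conical at every point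
in an exponential gauge slice. At a flat `τ` the unitary transports `(S_i f)(x) = Ad ρ(τ_{x,i}) f(x+e_i)` on `𝔤`-valued site
functions COMMUTE (flatness); with `T_i = S_i − 1` the linearised gauge action is `−T` and the linearised curvature is the Koszul
map `A ↦ T_i A_j − T_j A_i`, whose kernel is EXACTLY `im T ⊕ (∩ ker T_i)⁴` (pure linear algebra: `P = Σ T_i*T_i` is invertible
off the joint fixed space) — `stub_koszulH1`; on the slice `(im d⁰)^⊥` the action is two-sided comparable to
`Q(c) + ‖B‖²` (`c` the zero-mode part, `Q = Σ ‖[c_i(x), c_j(x)]‖²`; group commutators vs brackets — `stub_expCommutatorBracket`; the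
cross term vanishes identically because the transports fix the constant commutator), so scaling the slice coordinate by `s` costs a
factor `≤ K s²` in the action, the scaling map is well defined on the gauge tube and co-Lipschitz with constant `K/s` in the
Frobenius metric, Haar^E is a constant multiple of the `D`-dimensional Hausdorff measure of the matrix image
(`stub_haarCoLipschitz`), and Lipschitz maps shrink `μH[D]` by at most `Lip^D`: `V(t) ≤ K V(t/4)` for `t ≤ t₀` after a finite cover
of the compact flat set (`stub_sublevelDoubling`, the lead's stub, which takes the three ingredient statements as hypotheses).
Dyadic summation gives `⟨S²⟩_{L,β} ≤ K'/β²` on every fixed torus (`stub_secondMomentOfDoubling`) and `0 ≤ P ≤ S` gives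
`SmallTorusVarianceLaw` (`stub_smallTorusOfSecondMoment`). The physics stub and the composition below it are unchanged.

STATE (cycle 7, FINAL): every analytic stub is LANDED and cited by name below — workers: `stub_expCommutatorBracket` p132344,
`stub_koszulH1` p132262, `stub_haarCoLipschitz` p132907, `stub_secondMomentOfDoubling` p132525, `stub_smallTorusOfSecondMoment` p132185,
`stub_sliceLoc` p133809, `stub_sliceOpen` p134638; lead: `…CDoublingDefs` p132314, `…CDoublingConeAlgebra` p132766, `…CDoublingKoszul` p132861,
`…CDoublingPlaquette` p132953, `…CDoublingConePointwise` p133485, `…CDoublingCone` p133782, `…CDoublingCover` p133990, `…CDoublingSublevel`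
p134738 (`stub_sublevelDoubling`). EXACTLY ONE sorry remains: the physics `stub_afProfilesCore` (= `AFProfilesCore`, crux-sized; promote).
The small-torus clause (`SmallTorusVarianceLaw`, 2 ≤ L ≤ 7) is now a THEOREM — no named fact, no resolution of singularities.

Stubs (registered; self-contained signatures — Mathlib / Literature / route / landed-Theorems names only):
* `stub_afProfilesCore` (THE PHYSICS; crux-sized, open) — `AFProfilesCore` character for character (`afProfilesCore_iff_stub`);
* `stub_expCommutatorBracket` (matrix analysis), `stub_koszulH1` (linear algebra), `stub_haarCoLipschitz` (Haar scales like `μH[D]` under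
  co-Lipschitz maps of compact matrix groups), `stub_secondMomentOfDoubling` (Laplace: sublevel doubling ⇒ `⟨S²⟩ ≤ K'/β²`), `stub_smallTorusOfSecondMoment`
  (`⟨S²⟩ ≤ K'/β²` ⇒ `SmallTorusVarianceLawAt r`) — workers;
* `stub_sublevelDoubling` (the local conical package + cover ⇒ doubling of sublevel volumes; lead).
The four v6 reflection-positivity stubs are LANDED and cited by name below.
Composition: `FemtoCurvatureTwoPointC_of := femtoCurvatureTwoPointC_of_big_of_small (core ⇒ big) smallTorusVarianceLaw_of_stubs`.
-/

set_option autoImplicit false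

noncomputable section

open scoped Matrix Matrix.Norms.Frobenius ENNReal NNReal
open Filter Topology MeasureTheory
open Literature.MathematicalPhysics.QuantumFieldTheory
open Summit.QuantumFields.YangMills.Theorems.FemtoCurvatureTwoPointC

namespace Summit.QuantumFields.YangMills.Cruxes.FemtoCurvatureTwoPointC.Sketch

/-! ## The stubs (registered; self-contained signatures) -/

/-- **THE PHYSICS on femto boxes, interior separations (stub; crux-sized, open).** For every compact simple `G` (any Borel
structure) and faithful unitary `r`: an admissible finite-volume coupling `u L β` (positive, continuous, freezing, bare-sized at
`L = 8`) with in-window comparability and the two-sided averaged dyadic ASYMPTOTIC-FREEDOM STEP LAW, such that on every window BOX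
`L ≥ 8` at `β ≥ β₀`, with `f_L(s) = Cov_{L,β}(P_0^{01},P_{se₂}^{01})`, `g_L(s) = Cov_{L,β}(P_0^{01},P_{se₀}^{01})`: TRANSVERSE LOWER
`c·u(8n,β)² ≤ n⁸ f_L(n)` and TRANSVERSE UPPER `n⁸ f_L(n) ≤ C·u(8n,β)²` (`1 ≤ n`, `8n ≤ L`); LONGITUDINAL UPPER `s⁸ |g_L(s)| ≤ C·u(8s,β)²`
(`1 ≤ s`, `8s ≤ L`); VARIANCE CEILING `Var_{L,β}(P_0^{01}) ≤ C·u(8,β)²`. This is `AFProfilesCore` character for character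
(`afProfilesCore_iff_stub`, `…CDefsCore`) = v5's `AFProfilesBig` with the two upper-profile ranges cut to `8s ≤ L`. Not in print. -/
theorem stub_afProfilesCore :
      ∀ (G : Type) [Group G] [TopologicalSpace G] [IsTopologicalGroup G] [CompactSpace G]
        [MeasurableSpace G] [BorelSpace G], IsCompactSimpleLieGroup G →
        ∀ r : LatticeRep G, ∃ (u : ℕ → ℝ → ℝ) (u₀ β₀ κ₁ κ₂ κ₃ c C c₈ : ℝ),
          0 < u₀ ∧ 0 < c ∧ 0 < κ₁ ∧ 0 ≤ κ₃ ∧ 0 < c₈ ∧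
          (∀ (L : ℕ) (β : ℝ), 8 ≤ L → β₀ ≤ β → 0 < u L β) ∧
          (∀ L : ℕ, 8 ≤ L → ContinuousOn (u L) (Set.Ici β₀)) ∧
          (∀ L : ℕ, 8 ≤ L → Filter.Tendsto (u L) Filter.atTop (nhds 0)) ∧
          (∀ β : ℝ, β₀ ≤ β → c₈ ≤ β * u 8 β) ∧
          (∀ (L L' : ℕ) (β : ℝ), β₀ ≤ β → 8 ≤ L → L ≤ L' → L' ≤ 2 * L →
              (∀ M : ℕ, 8 ≤ M → M ≤ L → u M β ≤ u₀) → |(u L β)⁻¹ - (u L' β)⁻¹| ≤ κ₂) ∧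
          (∀ (k m : ℕ) (β : ℝ), β₀ ≤ β → (∀ M : ℕ, 8 ≤ M → M ≤ 8 * 2 ^ (k + m) → u M β ≤ u₀) →
              κ₁ * m - κ₃ ≤ (u (8 * 2 ^ k) β)⁻¹ - (u (8 * 2 ^ (k + m)) β)⁻¹ ∧
                (u (8 * 2 ^ k) β)⁻¹ - (u (8 * 2 ^ (k + m)) β)⁻¹ ≤ κ₂ * m + κ₃) ∧
          (∀ (L : ℕ) [NeZero L] (β : ℝ) (n : ℕ), β₀ ≤ β → 1 ≤ n → 8 * n ≤ L →
              (∀ M : ℕ, 8 ≤ M → M ≤ L → u M β ≤ u₀) →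
              ∀ (P : (Fin 4 → ZMod L) → Fin 4 → Fin 4 → GaugeConfig 4 L G → ℝ)
                (E : (GaugeConfig 4 L G → ℝ) → ℝ),
                (P = fun x i j U => (r.N : ℝ) - (r.ρ (plaquetteHolonomy U x i j)).trace.re) →
                (E = fun F => wilsonExpectation r.ρ β F) →
                c * u (8 * n) β ^ 2 ≤
                  (n : ℝ) ^ 8 * (E (fun U => P 0 0 1 U * P (Pi.single (2 : Fin 4) ((n : ℕ) : ZMod L)) 0 1 U)
                    - E (P 0 0 1) * E (P (Pi.single (2 : Fin 4) ((n : ℕ) : ZMod L)) 0 1))) ∧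
          (∀ (L : ℕ) [NeZero L] (β : ℝ) (s : ℕ), β₀ ≤ β → 8 ≤ L → 1 ≤ s → 8 * s ≤ L →
              (∀ M : ℕ, 8 ≤ M → M ≤ L → u M β ≤ u₀) →
              ∀ (P : (Fin 4 → ZMod L) → Fin 4 → Fin 4 → GaugeConfig 4 L G → ℝ)
                (E : (GaugeConfig 4 L G → ℝ) → ℝ),
                (P = fun x i j U => (r.N : ℝ) - (r.ρ (plaquetteHolonomy U x i j)).trace.re) →
                (E = fun F => wilsonExpectation r.ρ β F) →
                (s : ℝ) ^ 8 * (E (fun U => P 0 0 1 U * P (Pi.single (2 : Fin 4) ((s : ℕ) : ZMod L)) 0 1 U)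
                    - E (P 0 0 1) * E (P (Pi.single (2 : Fin 4) ((s : ℕ) : ZMod L)) 0 1)) ≤
                  C * u (8 * s) β ^ 2) ∧
          (∀ (L : ℕ) [NeZero L] (β : ℝ) (s : ℕ), β₀ ≤ β → 8 ≤ L → 1 ≤ s → 8 * s ≤ L →
              (∀ M : ℕ, 8 ≤ M → M ≤ L → u M β ≤ u₀) →
              ∀ (P : (Fin 4 → ZMod L) → Fin 4 → Fin 4 → GaugeConfig 4 L G → ℝ)
                (E : (GaugeConfig 4 L G → ℝ) → ℝ),
                (P = fun x i j U => (r.N : ℝ) - (r.ρ (plaquetteHolonomy U x i j)).trace.re) →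
                (E = fun F => wilsonExpectation r.ρ β F) →
                (s : ℝ) ^ 8 * |E (fun U => P 0 0 1 U * P (Pi.single (0 : Fin 4) ((s : ℕ) : ZMod L)) 0 1 U)
                    - E (P 0 0 1) * E (P (Pi.single (0 : Fin 4) ((s : ℕ) : ZMod L)) 0 1)| ≤
                  C * u (8 * s) β ^ 2) ∧
          (∀ (L : ℕ) [NeZero L] (β : ℝ), β₀ ≤ β → 8 ≤ L → (∀ M : ℕ, 8 ≤ M → M ≤ L → u M β ≤ u₀) →
              ∀ (P : (Fin 4 → ZMod L) → Fin 4 → Fin 4 → GaugeConfig 4 L G → ℝ)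
                (E : (GaugeConfig 4 L G → ℝ) → ℝ),
                (P = fun x i j U => (r.N : ℝ) - (r.ρ (plaquetteHolonomy U x i j)).trace.re) →
                (E = fun F => wilsonExpectation r.ρ β F) →
                E (fun U => P 0 0 1 U * P 0 0 1 U) - E (P 0 0 1) * E (P 0 0 1) ≤ C * u 8 β ^ 2) := by
  sorry

/-- **Group commutators vs Lie brackets (stub; matrix analysis).** For skew-Hermitian `a, b ∈ M_N(ℂ)` (Frobenius norm):
`‖e^a e^b e^{-a} e^{-b} − 1‖ ≤ ‖ab − ba‖` with NO smallness assumption, and `(1/4)‖ab − ba‖ ≤ ‖e^a e^b e^{-a} e^{-b} − 1‖` when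
`‖a‖, ‖b‖ ≤ 1/4`. Route: `‖e^a e^b e^{-a} e^{-b} − 1‖ = ‖e^{Ad(e^a) b} − e^b‖` (unitary invariance of the Frobenius norm, `e^a b e^{-a}`
exponentiates to `e^a e^b e^{-a}`), the exponential is `1`-Lipschitz on `𝔲(N)` (`FreeEnergyLogCoefficient.norm_exp_sub_exp_le_of_skew`)
and `(2 − e^r)`-co-Lipschitz on the `r`-ball (`…sub_mul_norm_sub_le_norm_exp_sub_exp`), and `t ↦ e^{ta} b e^{-ta}` has derivative
`e^{ta}(ab − ba)e^{-ta}` of constant norm `‖ab − ba‖` (`hasDerivAt_exp_smul_const`), so `‖Ad(e^a)b − b‖ ≤ ‖ab − ba‖` and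
`‖Ad(e^a)b − b − (ab − ba)‖ ≤ 2‖a‖‖ab − ba‖` (mean value again), whence `‖Ad(e^a) b − b‖ ≥ ‖ab − ba‖/2` and the lower
bound with `(2 − e^{3/8})/2 ≥ 1/4`. -/
theorem stub_expCommutatorBracket :
    ∀ (N : ℕ) (a b : Matrix (Fin N) (Fin N) ℂ), aᴴ = -a → bᴴ = -b →
      ‖NormedSpace.exp a * NormedSpace.exp b * NormedSpace.exp (-a) * NormedSpace.exp (-b) - 1‖ ≤ ‖a * b - b * a‖ ∧
      (‖a‖ ≤ 1 / 4 → ‖b‖ ≤ 1 / 4 →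
        1 / 4 * ‖a * b - b * a‖ ≤
          ‖NormedSpace.exp a * NormedSpace.exp b * NormedSpace.exp (-a) * NormedSpace.exp (-b) - 1‖) :=
  Summit.QuantumFields.YangMills.Theorems.FemtoCurvatureTwoPointC.stub_expCommutatorBracket  -- LANDED p132344

/-- **Koszul `H¹` for commuting isometries (stub; linear algebra).** Let `S₁,…,S_k` be pairwise commuting norm-preserving linear
maps of a finite-dimensional real inner product space `W`, `T_i = S_i − 1`. Every `1`-cocycle `X : Fin k → W`
(`T_i X_j = T_j X_i`) is a coboundary plus a joint fixed vector: `X_i = T_i m + c_i` with `S_j c_i = c_i` for all `i, j`.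
Proof: `W = W₀ ⊕ W₀^⊥`, `W₀ = ∩ ker T_i`, both `S`-invariant; `P = Σ_j T_j* T_j` (`T_j* = S_j⁻¹ − 1`) is invertible on `W₀^⊥` and
commutes with every `T_i`; for the `W₀^⊥`-components `m := P⁻¹ Σ_j T_j* X_j^⊥` works (`T_i m = P⁻¹ Σ_j T_j* T_i X_j^⊥ =
P⁻¹ Σ_j T_j* T_j X_i^⊥ = X_i^⊥`), and the `W₀`-components are joint fixed vectors. -/
theorem stub_koszulH1 :
    ∀ (W : Type) [NormedAddCommGroup W] [InnerProductSpace ℝ W] [FiniteDimensional ℝ W] (k : ℕ)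
      (S : Fin k → W →ₗ[ℝ] W), (∀ i w, ‖S i w‖ = ‖w‖) → (∀ i j w, S i (S j w) = S j (S i w)) →
      ∀ X : Fin k → W, (∀ i j, S i (X j) - X j = S j (X i) - X i) →
        ∃ (m : W) (c : Fin k → W), (∀ i j, S i (c j) = c j) ∧ ∀ i, X i = (S i m - m) + c i :=
  Summit.QuantumFields.YangMills.Theorems.FemtoCurvatureTwoPointC.stub_koszulH1  -- LANDED p132262

/-- **Haar measure scales under co-Lipschitz maps like a `D`-dimensional Hausdorff measure (stub; measure theory).** For a
compact group `G` with a faithful continuous unitary representation `ρ : G →* M_N(ℂ)` and a finite index type `ι` there is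
`D ≥ 0` (`= |ι| · dim 𝔤_ρ`) such that: whenever `F` maps a measurable `X ⊆ G^ι` into a measurable `Y` and is CO-LIPSCHITZ on `X`
by the factor `K` in the sup-of-Frobenius distance of the matrix image (`‖ρu − ρv‖ ≤ K ‖ρFu − ρFv‖` for `u, v ∈ X`), then
`Haar(X) ≤ C · K^D · Haar(Y)` (`C` independent of `K, X, Y, F`). Route: the product Haar probability measure equals `c · μH[D]` of the matrix image, `0 < c < ∞`
(left translations are isometries of the image, so `X ↦ μH[D](ρ^ι X)` is left invariant; it is finite and positive near `1`
because the product exponential chart `FreeEnergyLogCoefficient.expChart` is bi-Lipschitz from a Euclidean ball — Lipschitz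
`norm_rho_expChart_sub_le`, co-Lipschitz `le_norm_rho_expChart_sub` — on which `0 < μH[D] < ∞`, `hausdorffMeasure_pi_real`;
Haar uniqueness `isMulInvariant_eq_smul_of_compactSpace`), and `μH[D](X') ≤ K^D μH[D](F X')` for a `K`-antilipschitz `F`
(`AntilipschitzWith.le_hausdorffMeasure_image`), `F X ⊆ Y`. (Measurable structures on matrix spaces are the prover's choice
inside the proof; the statement mentions only Haar measure and norms.) -/
theorem stub_haarCoLipschitz :
    ∀ (G : Type) [Group G] [TopologicalSpace G] [IsTopologicalGroup G] [CompactSpace G] [MeasurableSpace G] [BorelSpace G]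
      (N : ℕ) (ρ : G →* Matrix (Fin N) (Fin N) ℂ), Continuous ρ → Function.Injective ρ →
      (∀ g, ρ g ∈ Matrix.unitaryGroup (Fin N) ℂ) →
      ∀ (ι : Type) [Fintype ι], ∃ (D : ℝ) (C : ℝ≥0), 0 ≤ D ∧
        ∀ (K : ℝ≥0) (X Y : Set (ι → G)), MeasurableSet X → MeasurableSet Y →
          ∀ F : (ι → G) → (ι → G), Set.MapsTo F X Y →
            (∀ u ∈ X, ∀ v ∈ X, ‖(fun e => ρ (u e) - ρ (v e))‖ ≤ K * ‖(fun e => ρ (F u e) - ρ (F v e))‖) →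
            Measure.pi (fun _ : ι => haarProbability G) X ≤
              (C : ℝ≥0∞) * (K : ℝ≥0∞) ^ D * Measure.pi (fun _ : ι => haarProbability G) Y :=
  Summit.QuantumFields.YangMills.Theorems.FemtoCurvatureTwoPointC.stub_haarCoLipschitz  -- LANDED p132907

/-- **Sublevel doubling ⇒ second-moment law (stub; Laplace estimate).** On a fixed torus: if the product-Haar volumes of the
sublevel sets of Wilson's action double near `0` (`V(t) ≤ K V(t/4)`, `0 < t ≤ t₀`), then `⟨S²⟩_{L,β} ≤ K'/β²` for `β ≥ β₀`.
Route (no asymptotics): `Z(β) ⟨S²⟩ = ∫ S² e^{−βS}`; split at the levels `t_k = t₀ 4^{−k}` above `1/β`: the block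
`{t_{k+1} < S ≤ t_k}` contributes `≤ t_k² e^{−β t_{k+1}} V(t_k) ≤ t_k² e^{−β t_{k+1}} K^{j+2} V(t_{k+j+2})` while
`Z(β) ≥ e^{−β t} V(t)` for every `t`; with `β t_{k+j+2} ≍ 1` the ratio is `β^{−2} y² e^{−y/4} K^{O(log y)}`, `y = β t_k`, summable
over the geometric sequence of `y`'s; the part `S ≤ 1/β` is `≤ β^{−2}`, the part `S > t₀` is exponentially small against
`Z(β) ≥ e^{−βt₀/4} V(t₀/4)`. Tree: `partitionFunction_toReal_eq_integral`, `wilsonExpectation`, `isProbabilityMeasure_wilsonMeasure`. -/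
theorem stub_secondMomentOfDoubling :
    ∀ (G : Type) [Group G] [TopologicalSpace G] [IsTopologicalGroup G] [CompactSpace G] [MeasurableSpace G] [BorelSpace G]
      (r : LatticeRep G) (L : ℕ) [NeZero L],
      (∃ (K : ℝ≥0) (t₀ : ℝ), 0 < t₀ ∧ ∀ t : ℝ, 0 < t → t ≤ t₀ →
          Measure.pi (fun _ : Edge 4 L => haarProbability G) {U : GaugeConfig 4 L G | wilsonAction r.ρ U ≤ t} ≤
            K * Measure.pi (fun _ : Edge 4 L => haarProbability G) {U : GaugeConfig 4 L G | wilsonAction r.ρ U ≤ t / 4}) →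
      ∃ (K' β₀ : ℝ), ∀ β : ℝ, β₀ ≤ β →
        wilsonExpectation r.ρ β (fun U : GaugeConfig 4 L G => wilsonAction r.ρ U ^ 2) ≤ K' / β ^ 2 :=
  Summit.QuantumFields.YangMills.Theorems.FemtoCurvatureTwoPointC.stub_secondMomentOfDoubling  -- LANDED p132525

/-- **Second-moment law ⇒ small-torus variance law (stub; bookkeeping).** `0 ≤ P_0^{01} ≤ S` pointwise, so
`Var_{L,β}(P_0^{01}) ≤ ⟨(P_0^{01})²⟩ ≤ ⟨S²⟩ ≤ K'(L)/β²`; take `K = max_{2≤L≤7} K'(L)`, `β₀ = max β₀(L)` (tree: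
`PlaquetteVariance.abs_var_le_wilsonExpectation_sq`, `sum_plaq01_le_wilsonAction`). -/
theorem stub_smallTorusOfSecondMoment :
    ∀ (G : Type) [Group G] [TopologicalSpace G] [IsTopologicalGroup G] [CompactSpace G] [MeasurableSpace G] [BorelSpace G]
      (r : LatticeRep G),
      (∀ (L : ℕ) [NeZero L], ∃ (K' β₀ : ℝ), ∀ β : ℝ, β₀ ≤ β →
          wilsonExpectation r.ρ β (fun U : GaugeConfig 4 L G => wilsonAction r.ρ U ^ 2) ≤ K' / β ^ 2) →
      SmallTorusVarianceLawAt r :=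
  Summit.QuantumFields.YangMills.Theorems.FemtoCurvatureTwoPointC.stub_smallTorusOfSecondMoment  -- LANDED p132185

/-- **Doubling of the sublevel volumes of Wilson's action (stub; the local conical package — lead).** For every compact `G`,
lattice representation `r` and torus `(ℤ/L)⁴`: `Haar^E{S ≤ t} ≤ K · Haar^E{S ≤ t/4}` for `0 < t ≤ t₀`. The three hypotheses are
the ingredient stubs `stub_expCommutatorBracket`, `stub_koszulH1`, `stub_haarCoLipschitz` verbatim. Proof plan (DOUBLING-BLUEPRINT.md):
at each flat `τ` the commuting transports `S_i`, Koszul `d⁰ = −T`, `d¹A = T_iA_j − T_jA_i`; slice `𝒴 = (im d⁰)^⊥ = 𝒞 ⊕ 𝒩`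
(`𝒞` zero modes, `d¹` injective on `𝒩` by `stub_koszulH1`); CONE `k(Q(c)+‖B‖²) ≤ S(cfg(c+B)) ≤ K(Q(c)+‖B‖²)` hence
`S(cfg(sA)) ≤ (K/k)s² S(cfg A)`; SLICE: `(h, A) ↦ gauge_h(cfg(sA))` is co-Lipschitz by `s/K'` against `(h, A) ↦ gauge_h(cfg A)`
(strict derivative at `0` + compactness of `G^V`); OPEN: the tube contains a neighbourhood of `τ` (inverse function theorem);
Haar scales like `μH[D]` under the co-Lipschitz scaling map (`stub_haarCoLipschitz`); finite cover of the compact flat set. -/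
theorem stub_sublevelDoubling :
    (∀ (N : ℕ) (a b : Matrix (Fin N) (Fin N) ℂ), aᴴ = -a → bᴴ = -b →
      ‖NormedSpace.exp a * NormedSpace.exp b * NormedSpace.exp (-a) * NormedSpace.exp (-b) - 1‖ ≤ ‖a * b - b * a‖ ∧
      (‖a‖ ≤ 1 / 4 → ‖b‖ ≤ 1 / 4 →
        1 / 4 * ‖a * b - b * a‖ ≤
          ‖NormedSpace.exp a * NormedSpace.exp b * NormedSpace.exp (-a) * NormedSpace.exp (-b) - 1‖)) →
    (∀ (W : Type) [NormedAddCommGroup W] [InnerProductSpace ℝ W] [FiniteDimensional ℝ W] (k : ℕ)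
      (S : Fin k → W →ₗ[ℝ] W), (∀ i w, ‖S i w‖ = ‖w‖) → (∀ i j w, S i (S j w) = S j (S i w)) →
      ∀ X : Fin k → W, (∀ i j, S i (X j) - X j = S j (X i) - X i) →
        ∃ (m : W) (c : Fin k → W), (∀ i j, S i (c j) = c j) ∧ ∀ i, X i = (S i m - m) + c i) →
    (∀ (G : Type) [Group G] [TopologicalSpace G] [IsTopologicalGroup G] [CompactSpace G] [MeasurableSpace G] [BorelSpace G]
      (N : ℕ) (ρ : G →* Matrix (Fin N) (Fin N) ℂ), Continuous ρ → Function.Injective ρ →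
      (∀ g, ρ g ∈ Matrix.unitaryGroup (Fin N) ℂ) →
      ∀ (ι : Type) [Fintype ι], ∃ (D : ℝ) (C : ℝ≥0), 0 ≤ D ∧
        ∀ (K : ℝ≥0) (X Y : Set (ι → G)), MeasurableSet X → MeasurableSet Y →
          ∀ F : (ι → G) → (ι → G), Set.MapsTo F X Y →
            (∀ u ∈ X, ∀ v ∈ X, ‖(fun e => ρ (u e) - ρ (v e))‖ ≤ K * ‖(fun e => ρ (F u e) - ρ (F v e))‖) →
            Measure.pi (fun _ : ι => haarProbability G) X ≤
              (C : ℝ≥0∞) * (K : ℝ≥0∞) ^ D * Measure.pi (fun _ : ι => haarProbability G) Y) →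
    ∀ (G : Type) [Group G] [TopologicalSpace G] [IsTopologicalGroup G] [CompactSpace G] [MeasurableSpace G] [BorelSpace G]
      (r : LatticeRep G) (L : ℕ) [NeZero L],
      ∃ (K : ℝ≥0) (t₀ : ℝ), 0 < t₀ ∧ ∀ t : ℝ, 0 < t → t ≤ t₀ →
        Measure.pi (fun _ : Edge 4 L => haarProbability G) {U : GaugeConfig 4 L G | wilsonAction r.ρ U ≤ t} ≤
          K * Measure.pi (fun _ : Edge 4 L => haarProbability G) {U : GaugeConfig 4 L G | wilsonAction r.ρ U ≤ t / 4} :=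
  Summit.QuantumFields.YangMills.Theorems.FemtoCurvatureTwoPointC.stub_sublevelDoubling  -- LANDED p134738

/-- **Longitudinal profile: non-negativity and symmetry (stub; reflection positivity).** For every compact `G`, continuous `ρ`,
torus `(ℤ/L)⁴`, `β ≥ 0`: the longitudinal profile `g(s) = Cov_{L,β}(P_0^{01}, P_{s e₀}^{01})` (`P = N − Re tr ρ(U_p)`, indices mod `L`)
satisfies `g(s) ≥ 0` for all `s` (variance at `s ≡ 0`; link-mirror pairs of TEMPORAL plaquettes at even separations and site-mirror
pairs at odd separations on even tori; odd-torus mirror pairs at even separations and `s ↦ L − s` on odd tori — tree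
`integral_timeReflect_mul_nonneg_even`, `integral_negReflect_mul_nonneg`, `integral_timeReflect_mul_nonneg_odd` with
`isPositiveTimeObservable_plaqRe_of_isPosPlaq` / `dependsOn_plaqRe_of_isSitePosPlaq` / `dependsOn_plaqRe_of_isOPosPlaq`) and
`g(L − s) = g(s)` for `s ≤ L` (`AxisCovNonneg.cov_origin_neg` after `Cov(N − A, N − B) = Cov(A, B)`, `AxisCovNonneg.cov_const_sub`). -/
theorem stub_longCovNonnegSymm :
    ∀ (L N : ℕ) [NeZero L] (G : Type) [Group G] [TopologicalSpace G] [IsTopologicalGroup G] [CompactSpace G] [MeasurableSpace G] [BorelSpace G] (ρ : G →* Matrix (Fin N) (Fin N) ℂ), Continuous ρ → ∀ (β : ℝ), 0 ≤ β → ∀ (g : ℕ → ℝ), (g = fun s : ℕ => wilsonExpectation ρ β (fun U : GaugeConfig 4 L G => ((N : ℝ) - (ρ (plaquetteHolonomy U 0 0 1)).trace.re) * ((N : ℝ) - (ρ (plaquetteHolonomy U (Pi.single (0 : Fin 4) ((s : ℕ) : ZMod L)) 0 1)).trace.re)) - wilsonExpectation ρ β (fun U : GaugeConfig 4 L G =>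 (N : ℝ) - (ρ (plaquetteHolonomy U 0 0 1)).trace.re) * wilsonExpectation ρ β (fun U : GaugeConfig 4 L G => (N : ℝ) - (ρ (plaquetteHolonomy U (Pi.single (0 : Fin 4) ((s : ℕ) : ZMod L)) 0 1)).trace.re)) → (∀ s : ℕ, 0 ≤ g s) ∧ (∀ s : ℕ, s ≤ L → g (L - s) = g s) :=
  Summit.QuantumFields.YangMills.Theorems.FemtoCurvatureTwoPointC.stub_longCovNonnegSymm  -- LANDED

/-- **Longitudinal profile: log-convexity (stub; reflection-positivity Cauchy–Schwarz).** Same data: `g(c)² ≤ g(c−1)·g(c+1)` for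
`2 ≤ c ≤ L − 2`. Even `L`: odd centre `c = 2a+1` from the LINK mirror of the temporal plaquette pair based at times `a, a+1`
(`AxisCovNonneg.cov_plaqReflect_sq_le_even`, `WilsonRP.IsPosPlaq`: `1 ≤ a`, `a + 2 ≤ L/2`), even centre `c = 2a+2` from the SITE mirror
(`cov_sitePlaqReflect_sq_le`, `WilsonSiteRP.IsSitePosPlaq`: `a + 1 < L/2`); odd `L`: odd centres from the odd-torus mirror
(`cov_plaqReflect_sq_le_odd`, `WilsonOddRP.IsOPosPlaq`), even centres by `c ↦ L − c`. Mirror images of temporal plaquettes: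
`WilsonRP.plaqReflect (a e₀, 01) = (−a e₀, 01)`, `WilsonSiteRP.sitePlaqReflect (a e₀, 01) = (−(a+1) e₀, 01)`; pairs translated to the
origin by `AxisCovNonneg.cov_pair_eq_origin`. -/
theorem stub_longLogConvex :
    ∀ (L N : ℕ) [NeZero L] (G : Type) [Group G] [TopologicalSpace G] [IsTopologicalGroup G] [CompactSpace G] [MeasurableSpace G] [BorelSpace G] (ρ : G →* Matrix (Fin N) (Fin N) ℂ), Continuous ρ → ∀ (β : ℝ), 0 ≤ β → ∀ (g : ℕ → ℝ), (g = fun s : ℕ => wilsonExpectation ρ β (fun U : GaugeConfig 4 L G => ((N : ℝ) - (ρ (plaquetteHolonomy U 0 0 1)).trace.re) * ((N : ℝ) - (ρ (plaquetteHolonomy U (Pi.single (0 : Fin 4) ((s : ℕ) : ZMod L)) 0 1)).trace.re)) - wilsonExpectation ρ β (fun U : GaugeConfig 4 L G => (N : ℝ) - (ρ (plaquetteHolonomy U 0 0 1)).trace.re) * wilsonExpectation ρ β (fun U : GaugeConfig 4 L G => (N : ℝ) - (ρ (plaquetteHolonomy U (Pi.single (0 : Fin 4) ((s : ℕ) : ZMod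 L)) 0 1)).trace.re)) → ∀ (c : ℕ), 2 ≤ c → c + 2 ≤ L → g c ^ 2 ≤ g (c - 1) * g (c + 1) :=
  Summit.QuantumFields.YangMills.Theorems.FemtoCurvatureTwoPointC.stub_longLogConvex  -- LANDED

/-- **Real sequences (stub).** A non-negative sequence, symmetric under `s ↦ L − s` on `[0, L]` and log-convex at the centres
`2 ≤ c ≤ L − 2`, is non-increasing on `[1, L/2]` (downward induction from `L/2`, as in `AxisCovNonneg.axisProfile_antitone`). -/
theorem stub_antitoneOfLogConvex :
    ∀ (L : ℕ) (g : ℕ → ℝ), (∀ s : ℕ, 0 ≤ g s) → (∀ s : ℕ, s ≤ L → g (L - s) = g s) → (∀ c : ℕ, 2 ≤ c → c + 2 ≤ L → g c ^ 2 ≤ g (c - 1) * g (c + 1)) → ∀ (k n : ℕ), 1 ≤ k → k ≤ n → 2 * n ≤ L → g n ≤ g k :=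
  Summit.QuantumFields.YangMills.Theorems.FemtoCurvatureTwoPointC.stub_antitoneOfLogConvex  -- LANDED

/-- **Bookkeeping bridge (stub): interior profiles + longitudinal monotonicity ⇒ `AFProfilesBigAt r`.** For every compact `G`
and lattice representation `r`: if the longitudinal profile of `r` is non-negative and non-increasing on `[1, L/2]` (the two
hypotheses, supplied by the three stubs above), then the v6 physics statement (third hypothesis = `AFProfilesCoreAt r` verbatim)
implies v5's `AFProfilesBigAt r`: window height `min u₀ (1/(4(|κ₂|+1)))`, threshold `max β₀ 1`, constant `2²⁶·max C 0`; for
`L/8 < s ≤ L/2` the transverse / longitudinal upper clauses follow from the clauses at `s₀ = L/8` (ℕ-division) by antitonicity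
(`FemtoCurvatureTwoPoint.stub_axisProfileAntitone` / hypothesis), non-negativity (`…stub_axisCovNonneg` / hypothesis), `(s/s₀)⁸ < 8⁸`
and `u(8s₀,β)² ≤ 4·u(L,β)²` (`stub_windowRatio`, `M₁ = 8s₀`, `M₂ = L`). -/
theorem stub_coreBridge :
    ∀ (G : Type) [Group G] [TopologicalSpace G] [IsTopologicalGroup G] [CompactSpace G] [MeasurableSpace G] [BorelSpace G] (r : LatticeRep G), (∀ (L : ℕ) [NeZero L] (β : ℝ), 0 ≤ β → ∀ s : ℕ, 0 ≤ wilsonExpectation r.ρ β (fun U : GaugeConfig 4 L G => ((r.N : ℝ) - (r.ρ (plaquetteHolonomy U 0 0 1)).trace.re) * ((r.N : ℝ) - (r.ρ (plaquetteHolonomy U (Pi.single (0 : Fin 4) ((s : ℕ) : ZMod L)) 0 1)).trace.re)) - wilsonExpectation r.ρ β (fun U : GaugeConfig 4 L G => (r.N : ℝ) - (r.ρ (plaquetteHolonomy U 0 0 1)).trace.re) * wilsonExpectation r.ρ β (fun U : GaugeConfig 4 L G => (r.N : ℝ) - (r.ρ (plaquetteHolonomy U (Pi.single (0 : Fin 4)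 ((s : ℕ) : ZMod L)) 0 1)).trace.re)) → (∀ (L : ℕ) [NeZero L] (β : ℝ), 0 ≤ β → ∀ k n : ℕ, 1 ≤ k → k ≤ n → 2 * n ≤ L → wilsonExpectation r.ρ β (fun U : GaugeConfig 4 L G => ((r.N : ℝ) - (r.ρ (plaquetteHolonomy U 0 0 1)).trace.re) * ((r.N : ℝ) - (r.ρ (plaquetteHolonomy U (Pi.single (0 : Fin 4) ((n : ℕ) : ZMod L)) 0 1)).trace.re)) - wilsonExpectation r.ρ β (fun U : GaugeConfig 4 L G => (r.N : ℝ) - (r.ρ (plaquetteHolonomy U 0 0 1)).trace.re) * wilsonExpectation r.ρ β (fun U : GaugeConfig 4 L G => (r.N : ℝ) - (r.ρ (plaquetteHolonomy U (Pi.single (0 : Fin 4) ((n : ℕ) : ZMod L)) 0 1)).trace.re) ≤ wilsonExpectation r.ρ β (fun U : GaugeConfig 4 L G => ((r.N : ℝ) - (r.ρ (plaquetteHolonomy U 0 0 1)).trace.re) * ((r.N : ℝ) - (r.ρ (plaquetteHolonomy U (Pi.single (0 : Fin 4) ((k : ℕ) : ZMod L)) 0 1)).trace.re)) - wilsonExpectation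 r.ρ β (fun U : GaugeConfig 4 L G => (r.N : ℝ) - (r.ρ (plaquetteHolonomy U 0 0 1)).trace.re) * wilsonExpectation r.ρ β (fun U : GaugeConfig 4 L G => (r.N : ℝ) - (r.ρ (plaquetteHolonomy U (Pi.single (0 : Fin 4) ((k : ℕ) : ZMod L)) 0 1)).trace.re)) → (∃ (u : ℕ → ℝ → ℝ) (u₀ β₀ κ₁ κ₂ κ₃ c C c₈ : ℝ), 0 < u₀ ∧ 0 < c ∧ 0 < κ₁ ∧ 0 ≤ κ₃ ∧ 0 < c₈ ∧ (∀ (L : ℕ) (β : ℝ), 8 ≤ L → β₀ ≤ β → 0 < u L β) ∧ (∀ L : ℕ, 8 ≤ L → ContinuousOn (u L) (Set.Ici β₀)) ∧ (∀ L : ℕ, 8 ≤ L → Filter.Tendsto (u L) Filter.atTop (nhds 0)) ∧ (∀ β : ℝ, β₀ ≤ β → c₈ ≤ β * u 8 β) ∧ (∀ (L L' : ℕ) (β : ℝ), β₀ ≤ β → 8 ≤ L → L ≤ L' → L' ≤ 2 * L → (∀ M : ℕ, 8 ≤ M → M ≤ L → u M β ≤ u₀) → |(u L β)⁻¹ - (u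 L' β)⁻¹| ≤ κ₂) ∧ (∀ (k m : ℕ) (β : ℝ), β₀ ≤ β → (∀ M : ℕ, 8 ≤ M → M ≤ 8 * 2 ^ (k + m) → u M β ≤ u₀) → κ₁ * m - κ₃ ≤ (u (8 * 2 ^ k) β)⁻¹ - (u (8 * 2 ^ (k + m)) β)⁻¹ ∧ (u (8 * 2 ^ k) β)⁻¹ - (u (8 * 2 ^ (k + m)) β)⁻¹ ≤ κ₂ * m + κ₃) ∧ (∀ (L : ℕ) [NeZero L] (β : ℝ) (n : ℕ), β₀ ≤ β → 1 ≤ n → 8 * n ≤ L → (∀ M : ℕ, 8 ≤ M → M ≤ L → u M β ≤ u₀) → ∀ (P : (Fin 4 → ZMod L) → Fin 4 → Fin 4 → GaugeConfig 4 L G → ℝ) (E : (GaugeConfig 4 L G → ℝ) → ℝ), (P = fun x i j U => (r.N : ℝ) - (r.ρ (plaquetteHolonomy U x i j)).trace.re) → (E = fun F => wilsonExpectation r.ρ β F) → c * u (8 * n) β ^ 2 ≤ (n : ℝ) ^ 8 * (E (fun U => P 0 0 1 U * P (Pi.single (2 : Fin 4) ((n : ℕ) : ZMod L)) 0 1 U)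 - E (P 0 0 1) * E (P (Pi.single (2 : Fin 4) ((n : ℕ) : ZMod L)) 0 1))) ∧ (∀ (L : ℕ) [NeZero L] (β : ℝ) (s : ℕ), β₀ ≤ β → 8 ≤ L → 1 ≤ s → 8 * s ≤ L → (∀ M : ℕ, 8 ≤ M → M ≤ L → u M β ≤ u₀) → ∀ (P : (Fin 4 → ZMod L) → Fin 4 → Fin 4 → GaugeConfig 4 L G → ℝ) (E : (GaugeConfig 4 L G → ℝ) → ℝ), (P = fun x i j U => (r.N : ℝ) - (r.ρ (plaquetteHolonomy U x i j)).trace.re) → (E = fun F => wilsonExpectation r.ρ β F) → (s : ℝ) ^ 8 * (E (fun U => P 0 0 1 U * P (Pi.single (2 : Fin 4) ((s : ℕ) : ZMod L)) 0 1 U) - E (P 0 0 1) * E (P (Pi.single (2 : Fin 4) ((s : ℕ) : ZMod L)) 0 1)) ≤ C * u (8 * s) β ^ 2) ∧ (∀ (L : ℕ) [NeZero L] (β : ℝ) (s : ℕ), β₀ ≤ β → 8 ≤ L → 1 ≤ s → 8 * s ≤ L → (∀ M : ℕ, 8 ≤ M → M ≤ L → u M β ≤ u₀) → ∀ (P : (Fin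 4 → ZMod L) → Fin 4 → Fin 4 → GaugeConfig 4 L G → ℝ) (E : (GaugeConfig 4 L G → ℝ) → ℝ), (P = fun x i j U => (r.N : ℝ) - (r.ρ (plaquetteHolonomy U x i j)).trace.re) → (E = fun F => wilsonExpectation r.ρ β F) → (s : ℝ) ^ 8 * |E (fun U => P 0 0 1 U * P (Pi.single (0 : Fin 4) ((s : ℕ) : ZMod L)) 0 1 U) - E (P 0 0 1) * E (P (Pi.single (0 : Fin 4) ((s : ℕ) : ZMod L)) 0 1)| ≤ C * u (8 * s) β ^ 2) ∧ (∀ (L : ℕ) [NeZero L] (β : ℝ), β₀ ≤ β → 8 ≤ L → (∀ M : ℕ, 8 ≤ M → M ≤ L → u M β ≤ u₀) → ∀ (P : (Fin 4 → ZMod L) → Fin 4 → Fin 4 → GaugeConfig 4 L G → ℝ) (E : (GaugeConfig 4 L G → ℝ) → ℝ), (P = fun x i j U => (r.N : ℝ) - (r.ρ (plaquetteHolonomy U x i j)).trace.re) → (E = fun F => wilsonExpectation r.ρ β F) → E (fun U => P 0 0 1 U * P 0 0 1 U) - E (P 0 0 1) * E (P 0 0 1) ≤ C * u 8 β ^ 2))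 → AFProfilesBigAt r :=
  Summit.QuantumFields.YangMills.Theorems.FemtoCurvatureTwoPointC.stub_coreBridge  -- LANDED

/-! ## Glue (sorry-free; the same glue is LANDED as `…CCoreBridge`, p130194) -/

/-- The longitudinal profile of a lattice representation is non-negative (from `stub_longCovNonnegSymm`; landed `longCovNonneg_rep`). -/
theorem longCovNonneg_rep' {G : Type} [Group G] [TopologicalSpace G] [IsTopologicalGroup G] [CompactSpace G]
    [MeasurableSpace G] [BorelSpace G] (r : LatticeRep G) :
    ∀ (L : ℕ) [NeZero L] (β : ℝ), 0 ≤ β → ∀ s : ℕ, 0 ≤ wilsonExpectation r.ρ β (fun U : GaugeConfig 4 L G => ((r.N : ℝ) - (r.ρ (plaquetteHolonomy U 0 0 1)).trace.re) * ((r.N : ℝ) - (r.ρ (plaquetteHolonomy U (Pi.single (0 : Fin 4) ((s : ℕ) : ZMod L)) 0 1)).trace.re)) - wilsonExpectation r.ρ β (fun U : GaugeConfig 4 L G => (r.N : ℝ) - (r.ρ (plaquetteHolonomy U 0 0 1)).trace.re) * wilsonExpectation r.ρ β (fun U : GaugeConfig 4 L G => (r.N : ℝ) - (r.ρ (plaquetteHolonomy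 U (Pi.single (0 : Fin 4) ((s : ℕ) : ZMod L)) 0 1)).trace.re) := by
  intro L _ β hβ s
  exact (stub_longCovNonnegSymm L r.N G r.ρ r.continuous β hβ _ rfl).1 s

/-- The longitudinal profile of a lattice representation is non-increasing on `[1, L/2]` (from the three longitudinal stubs; landed
`longCovAntitone_rep`). -/
theorem longCovAntitone_rep' {G : Type} [Group G] [TopologicalSpace G] [IsTopologicalGroup G] [CompactSpace G]
    [MeasurableSpace G] [BorelSpace G] (r : LatticeRep G) :
    ∀ (L : ℕ) [NeZero L] (β : ℝ), 0 ≤ β → ∀ k n : ℕ, 1 ≤ k → k ≤ n → 2 * n ≤ L → wilsonExpectation r.ρ β (fun U : GaugeConfig 4 L G => ((r.N : ℝ) - (r.ρ (plaquetteHolonomy U 0 0 1)).trace.re) * ((r.N : ℝ) - (r.ρ (plaquetteHolonomy U (Pi.single (0 : Fin 4) ((n : ℕ) : ZMod L)) 0 1)).trace.re)) - wilsonExpectation r.ρ β (fun U : GaugeConfig 4 L G => (r.N : ℝ) - (r.ρ (plaquetteHolonomy U 0 0 1)).trace.re) * wilsonExpectation r.ρ β (fun U : GaugeConfig 4 L G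 => (r.N : ℝ) - (r.ρ (plaquetteHolonomy U (Pi.single (0 : Fin 4) ((n : ℕ) : ZMod L)) 0 1)).trace.re) ≤ wilsonExpectation r.ρ β (fun U : GaugeConfig 4 L G => ((r.N : ℝ) - (r.ρ (plaquetteHolonomy U 0 0 1)).trace.re) * ((r.N : ℝ) - (r.ρ (plaquetteHolonomy U (Pi.single (0 : Fin 4) ((k : ℕ) : ZMod L)) 0 1)).trace.re)) - wilsonExpectation r.ρ β (fun U : GaugeConfig 4 L G => (r.N : ℝ) - (r.ρ (plaquetteHolonomy U 0 0 1)).trace.re) * wilsonExpectation r.ρ β (fun U : GaugeConfig 4 L G => (r.N : ℝ) - (r.ρ (plaquetteHolonomy U (Pi.single (0 : Fin 4) ((k : ℕ) : ZMod L)) 0 1)).trace.re) := by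
  intro L _ β hβ k n hk hkn hn
  obtain ⟨h0, hsymm⟩ := stub_longCovNonnegSymm L r.N G r.ρ r.continuous β hβ _ rfl
  have hlc := stub_longLogConvex L r.N G r.ρ r.continuous β hβ _ rfl
  exact stub_antitoneOfLogConvex L _ h0 hsymm hlc k n hk hkn hn

/-- **v6 bridge at fixed data** (landed `afProfilesBigAt_of_afProfilesCoreAt`): the interior-profile physics statement implies v5's
`AFProfilesBigAt r` — longitudinal monotonicity from the three RP stubs, then `stub_coreBridge`. -/
theorem afProfilesBigAt_of_core {G : Type} [Group G] [TopologicalSpace G] [IsTopologicalGroup G] [CompactSpace G]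
    [MeasurableSpace G] [BorelSpace G] (r : LatticeRep G) (h : AFProfilesCoreAt r) : AFProfilesBigAt r :=
  stub_coreBridge G r (longCovNonneg_rep' r) (longCovAntitone_rep' r) h

/-! ## Composition -/

/-- **Small tori, now OFF the named fact.** `SmallTorusVarianceLaw` from the doubling chain: ingredient stubs ⇒ sublevel
doubling (`stub_sublevelDoubling`) ⇒ `⟨S²⟩ ≤ K'/β²` (`stub_secondMomentOfDoubling`) ⇒ `Var(P) ≤ K/β²` on `2 ≤ L ≤ 7`
(`stub_smallTorusOfSecondMoment`). The hypothesis `IsCompactSimpleLieGroup G` is not used. -/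
theorem smallTorusVarianceLaw_of_stubs : SmallTorusVarianceLaw := by
  intro G _ _ _ _ _ _ _hG r
  exact stub_smallTorusOfSecondMoment G r fun L _ =>
    stub_secondMomentOfDoubling G r L
      (stub_sublevelDoubling stub_expCommutatorBracket stub_koszulH1 stub_haarCoLipschitz G r L)

/-- **Composition.** The stubs conclude the crux BY NAME: interior profiles ⇒ (reflection positivity) `AFProfilesBig` ⇒ (v5
bridge `femtoCurvatureTwoPointC_of_big_of_small`: RP pairs bridge on boxes, Cauchy–Schwarz + bare size on small tori, E-a/E-b) the
crux, the small-torus variance law being supplied by the elementary doubling chain `smallTorusVarianceLaw_of_stubs`. -/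
theorem FemtoCurvatureTwoPointC_of :
    Summit.QuantumFields.YangMills.Theses.LangevinControlUV.FemtoCurvatureTwoPointC :=
  femtoCurvatureTwoPointC_of_big_of_small
    (fun G _ _ _ _ _ _ hG r => afProfilesBigAt_of_core r ((afProfilesCore_iff_stub.mpr stub_afProfilesCore) G hG r))
    smallTorusVarianceLaw_of_stubs

end Summit.QuantumFields.YangMills.Cruxes.FemtoCurvatureTwoPointC.Sketch

end
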